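import Summits.BirchSwinnertonDyer.BirchSwinnertonDyer.Theorems.ResidualThetaTransportAtTwoHeckeThetaPartnerAdicAtTwoThetaLinesSpan
import Mathlib.NumberTheory.ModularForms.Basic
import Mathlib.NumberTheory.ModularForms.CongruenceSubgroups
import HarnessLib

/-!
# A `Γ₀(N)`-invariant function in the theta span is a weight-two cusp form (toward K0⁺, stmt-20690)

Route `ResidualThetaTransportAtTwo`, crux K0⁺ `HeckeThetaPartnerAdicAtTwo` (stmt-BirchSwinnertonDyer-20690),
line "Hecke theta series from the genus-two Riemann theta function".  THEOREMS ONLY.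

`exists_cuspForm_of_mem_span`: if `f` lies in the span `V` of the gradient theta nulls on rational
lines (`ThetaLinesSpan`) and `f ∣₂ γ = f` for all `γ ∈ Γ₀(N)`, then `f` is (the function of) a cusp
form of weight `2` on `Γ₀(N)`: holomorphy and vanishing at EVERY cusp come from `V ∣₂ SL₂(ℤ) ⊆ V`
(`slash_mem_span`), each element of `V` being holomorphic and `o(1)` at `i∞`.

BSD is not proved by this file.
-/

set_option autoImplicit false
set_option linter.dupNamespace false

noncomputable section

open scoped Real MatrixGroups UpperHalfPlane Topology Manifold ModularForm
open Matrix Complex Filter CongruenceSubgroup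

namespace Summit.BirchSwinnertonDyer.BirchSwinnertonDyer.Theorems.HeckeTheta

open Literature.Analysis.SpecialFunctions

/-- **A `Γ₀(N)`-invariant function in the theta span is a cusp form of weight `2`.** -/
theorem exists_cuspForm_of_mem_span (N : ℕ) [NeZero N] {f : ℍ → ℂ}
    (hf : f ∈ Submodule.span ℂ {F : ℍ → ℂ | ∃ (P : Matrix (Fin 2) (Fin 2) ℚ), P.IsSymm ∧
        (P.map (Rat.cast : ℚ → ℝ)).PosDef ∧ ∃ (a b : Fin 2 → ℚ) (u : Fin 2 → ℂ), F = fun τ : ℍ =>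
          fderiv ℂ (riemannThetaChar (fun i => (a i : ℂ)) (fun i => (b i : ℂ))
            ((τ : ℂ) • P.map (Rat.cast : ℚ → ℂ))) 0 u})
    (hinv : ∀ γ : SL(2, ℤ), γ ∈ Gamma0 N → f ∣[(2 : ℤ)] γ = f) :
    ∃ g : CuspForm (Gamma0 N) 2, (⇑g : ℍ → ℂ) = f := by
  refine ⟨{ toFun := f,
             slash_action_eq' := fun γ hγ => ?_,
             holo' := mdifferentiable_of_mem_span hf,
             zero_at_cusps' := fun {c} hc => ?_ }, rfl⟩
  · obtain ⟨γ₀, hγ₀, rfl⟩ := hγ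
    exact (show f ∣[(2 : ℤ)] (γ₀ : GL (Fin 2) ℝ) = f by
      rw [← ModularForm.SL_slash]; exact hinv γ₀ hγ₀)
  · rw [Subgroup.IsArithmetic.isCusp_iff_isCusp_SL2Z] at hc
    rw [OnePoint.isZeroAt_iff_forall_SL2Z hc]
    intro γ _
    exact isZeroAtImInfty_of_mem_span (slash_mem_span γ hf)

end Summit.BirchSwinnertonDyer.BirchSwinnertonDyer.Theorems.HeckeTheta

end
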